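import Mathlib.Data.Nat.Log
import Mathlib.Data.ZMod.Basic
import Mathlib.Algebra.BigOperators.Ring.Finset
import Literature.Computability.Complexity.ConstantDepth
import Literature.Computability.Complexity.NCRealize
import HarnessLib

/-!
# `PARITY ∈ NC¹` (discharge of the named fact `PARITY_mem_NC1`)

This file proves the named fact `PARITY_mem_NC1 : PARITY ∈ NC1` of `ConstantDepth.lean`
(`theorem PARITY_mem_NC1_holds`). The proof is the textbook one: the parity of `n ≥ 1` bits is
computed by a balanced binary tree of `n - 1` binary parity gates `⊕₂` (fan-in `2`, hence in the
basis `B₂`), of depth `⌈log₂ n⌉ ≤ log₂ n + 1`; for `n = 0` the parity is the constant `false`,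
one gate of arity `0`. The tree is assembled with the bounded fan-in toolkit of `NCRealize.lean`
(`NCVec.treeGadget`, `NCVec.toCircuit`), and its semantics is read off through the homomorphism
`b ↦ [b] ∈ ℤ/2ℤ` (`treeFold_map`, `treeFold_add`).

The proof lives in this sibling file rather than in `ConstantDepth.lean` itself because
`NCRealize.lean` imports `ConstantDepth.lean`.

## References

* S. Arora, B. Barak, *Computational Complexity: A Modern Approach* (2009), Example 6.26
  (`PARITY ∈ NC¹` by a binary tree of parity gates; book p. 118), Def. 6.24 (`NCᵈ`).
* H. Vollmer, *Introduction to Circuit Complexity* (1999), Def. 4.1 (`NCⁱ`), §1.3.1, Cor. 1.22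
  (`BCOUNT ∈ FDEPTH(log n)`, of which parity is the low-order output bit). (The locator
  "Cor. 1.31" in the docstring of `PARITY_mem_NC1` is a slip: Vollmer's Thm. 1.31 is transitive
  closure; the statement itself is the standard one and is proved here as stated.)
-/

namespace Literature.Computability.Complexity

open Finset

/-! ### The parity tree -/

/-- The binary parity gadget `⊕₂` on one-bit values, read off the two halves of
`Fin 1 ⊕ Fin 1`: one `B₂`-gate, depth `1`, size `1` (Arora–Barak 2009, Example 6.26: "the gate
at the top computes the parity of these two bits"). [cite: AroraBarak2009, Example 6.26] -/
theorem ncVec_xor₂ :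
    NCVec (fun (y : Fin 1 ⊕ Fin 1 → Bool) =>
      (fun (u v : Fin 1 → Bool) (_ : Fin 1) => (u 0 ^^ v 0)) (fun i => y (.inl i))
        fun i => y (.inr i)) 1 1 :=
  ((((ncVec_proj (_root_.id : Fin 1 ⊕ Fin 1 → Fin 1 ⊕ Fin 1)).gate₂ (· ^^ ·) (.inl 0)
    (.inr 0)).outMap fun _ : Fin 1 => ()).congr fun _ _ => rfl).mono (by simp) (by simp)

/-- **Semantics of the parity tree**: the balanced fold of `⊕₂` over the bits `x₀, …, x_{M-1}`
(with neutral value `false`) is the parity `⊕ᴹ(x)` — read through the homomorphism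
`b ↦ [b] : ({0,1}, ⊕) → (ℤ/2ℤ, +)`, the fold becomes `∑ⱼ xⱼ mod 2`
(Arora–Barak 2009, Example 6.26; §14.1: `⊕(x₁,…,xₙ) = Σᵢ xᵢ (mod 2)`). [cite: AroraBarak2009, Example 6.26] -/
theorem treeFold_xor₂_apply (M : ℕ) (x : Fin M → Bool) :
    treeFold (fun (u v : Fin 1 → Bool) (_ : Fin 1) => (u 0 ^^ v 0)) (fun _ => false) M
        (fun j _ => x j) 0 = parityFn M x := by
  have hmap := treeFold_map (fun (u v : Fin 1 → Bool) (_ : Fin 1) => (u 0 ^^ v 0))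
    (fun _ => false) (· + ·) (0 : ZMod 2) (fun u => if u 0 then 1 else 0)
    (fun a b => by
      dsimp only
      cases a 0 <;> cases b 0 <;> decide)
    (by simp) M (fun j _ => x j)
  rw [treeFold_add] at hmap
  simp only [Finset.sum_boole] at hmap
  -- `hmap : (if t 0 then 1 else 0 : ZMod 2) = #{j | x j}` for the fold `t`
  generalize treeFold (fun (u v : Fin 1 → Bool) (_ : Fin 1) => (u 0 ^^ v 0)) (fun _ => false) M
    (fun j _ => x j) = t at hmap ⊢
  unfold parityFn GateFn.numOnes
  cases h0 : t 0
  · rw [h0, if_neg Bool.false_ne_true, eq_comm, ZMod.natCast_eq_zero_iff_even, Nat.even_iff]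
      at hmap
    rw [eq_comm, decide_eq_false_iff_not]
    omega
  · rw [h0, if_pos rfl, eq_comm, ZMod.natCast_eq_one_iff_odd, Nat.odd_iff] at hmap
    rw [eq_comm, decide_eq_true_iff]
    exact hmap

/-- **The parity circuits**: for every `n`, a `B₂`-circuit on `n` inputs of depth at most
`⌈log₂ n⌉ + 1` (negations free, indeed of depth `≤ ⌈log₂ n⌉ + 1`) and size at most `n + 1`
computing `⊕ⁿ` — for `n ≥ 1` the balanced tree of `n - 1` gates `⊕₂` (depth `⌈log₂ n⌉`), for
`n = 0` the constant gate `false` (Arora–Barak 2009, Example 6.26; Vollmer 1999, Cor. 1.22). [cite: AroraBarak2009, Example 6.26] -/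
theorem exists_parity_circuit (n : ℕ) :
    ∃ C : Circuit (Fin n), C.IsOver B2 ∧ C.acDepth ≤ Nat.clog 2 n + 1 ∧ C.size ≤ n + 1 ∧
      ∀ x, C.eval x = parityFn n x := by
  rcases Nat.eq_zero_or_pos n with rfl | hn
  · obtain ⟨C, hB, hd, hs, hev⟩ :=
      (ncVec_gate ⟨0, fun _ => false⟩ (by simp [B2]) (Fin.elim0 : Fin 0 → Fin 0)).toCircuit
    refine ⟨C, hB, hd.trans (by simp), hs.trans (by simp), fun x => ?_⟩
    rw [hev]
    simp [parityFn, GateFn.numOnes]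
  · have htree := NCVec.treeGadget (b := 1)
      (op := fun (u v : Fin 1 → Bool) (_ : Fin 1) => (u 0 ^^ v 0)) ncVec_xor₂ (fun _ => false)
      n hn
    have h := ((ncVec_proj (ι := Fin n) fun p : Fin n × Fin 1 => p.1).comp htree).outMap
      fun _ : Unit => (0 : Fin 1)
    obtain ⟨C, hB, hd, hs, hev⟩ := (h.congr fun x _ => treeFold_xor₂_apply n x).toCircuit
    exact ⟨C, hB, hd.trans (by omega), hs.trans (by omega), hev⟩

/-! ### `PARITY ∈ NC¹` -/

/-- **`PARITY ∈ NC¹`** (discharge of `PARITY_mem_NC1`): the family of parity trees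
(`exists_parity_circuit`) is over `B₂`, has depth `≤ ⌈log₂ n⌉ + 1 ≤ 2 · log₂ n + 2`, size
`≤ n + 1`, and decides `PARITY` (Arora–Barak 2009, Example 6.26 with Def. 6.24; Vollmer 1999,
Def. 4.1 and Cor. 1.22). [cite: AroraBarak2009, Example 6.26] -/
theorem PARITY_mem_NC1_holds : PARITY_mem_NC1 := by
  choose C hC using exists_parity_circuit
  refine ⟨2, Polynomial.X + 1, C, fun n => ⟨(hC n).1, ?_, ?_⟩, fun x => ?_⟩
  · have h1 : Nat.clog 2 n ≤ Nat.log 2 n + 1 :=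
      Nat.clog_le_of_le_pow (Nat.lt_pow_succ_log_self one_lt_two n).le
    have h2 := (hC n).2.1
    show (C n).acDepth ≤ 2 * Nat.log 2 n ^ 1 + 2
    rw [pow_one]
    omega
  · have h3 := (hC n).2.2.1
    simp only [Polynomial.eval_add, Polynomial.eval_X, Polynomial.eval_one]
    exact h3
  · rw [(hC x.length).2.2.2]
    by_cases hx : x ∈ PARITY
    · rw [(Set.mem_iff_boolIndicator _ _).1 hx]
      exact hx
    · rw [(Set.notMem_iff_boolIndicator _ _).1 hx]
      exact Bool.eq_false_iff.mpr hx

end Literature.Computability.Complexity
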